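import Literature.Algebra.EuclideanLattices.BabaiIntegral
import Literature.Algebra.EuclideanLattices.BabaiBackSubstitution
import HarnessLib

/-!
# Babai's coefficients from ONE integer Gram–Schmidt table: back-substitution on Cohen's data

Topic `Algebra/EuclideanLattices` (family `pqc`), sequel of `BabaiIntegral.lean` (`Babai.intNearestPlane`,
`intNearestPlane_eq`, `uRec_snoc_cast_eq_gsU`, `roundDiv`) and `BabaiBackSubstitution.lean`
(`nearestPlane_eq_round_backSub`). Everything is PROVED; one definition with body (`Babai.intBackSub`);
no named fact.

`Babai.intNearestPlane` recomputes Cohen's table for every shifted target `w - z b_k`. A machine does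
better (Babai 1986, §3, with the orthogonalised basis computed once): from the SINGLE table of the
extended family `(b₀, …, b_{n-1}, w)` it reads, for every level `j < n`,

  `Λⱼ(i) = u_j(bᵢ, bⱼ) = dⱼ⟪bᵢ, b̃ⱼ⟫`,  `Λⱼ(w) = u_j(w, bⱼ) = dⱼ⟪w, b̃ⱼ⟫`,  `d_{j+1} = dⱼ‖b̃ⱼ‖²`,

and back-substitutes from the top: `z_{n-1} = ⌊Λ_{n-1}(w)/d_n⌉`, then the target row is updated LINEARLY,
`Λⱼ(w) ← Λⱼ(w) - z_{n-1} Λⱼ(b_{n-1})` (this is `dⱼ⟪w - z b_{n-1}, b̃ⱼ⟫`), and one continues with the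
prefix. This file defines that recursion on abstract integer data and proves it IS Babai's algorithm:

* `Babai.intBackSub n lamB lamW d` — the recursion (data: `lamB i j = Λⱼ(bᵢ)`, `lamW j = Λⱼ(w)`,
  `d j = d_{j+1}`);
* **`Babai.intBackSub_eq_nearestPlane`** — for any family `f` with nonzero Gram–Schmidt vectors, any
  target `c` and any POSITIVE scalings `Kⱼ`, integer data with `lamB i j = Kⱼ⟪fᵢ, b̃ⱼ⟫`,
  `lamW j = Kⱼ⟪c, b̃ⱼ⟫`, `d j = Kⱼ‖b̃ⱼ‖²` give `intBackSub = nearestPlane n f c` (structural induction,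
  exactly as `intNearestPlane_eq`);
* **`Babai.intBackSub_uRec_eq_intNearestPlane`** — with Cohen's data of the extended family
  (`Kⱼ = dⱼ`: `lamB i j = uRec (b, w) j i j`, `lamW j = uRec (b, w) j n j`, `d j = dRec (b, w) (j+1)`),
  for linearly independent integer rows: `intBackSub = intNearestPlane n b w` (hence its residual is
  `Babai.intResidual b w`, `intVecToEuclidean_intResidual`).

## References

* L. Babai, *On Lovász' lattice reduction and the nearest lattice point problem*, Combinatorica 6 (1986)
  1–13, §3 (procedure NEAREST PLANE against the fixed `b*ⱼ`) [Babai1986].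
* H. Cohen, *A Course in Computational Algebraic Number Theory*, GTM 138, Springer 1993, §2.6.3 and
  Algorithm 2.6.7 (`λᵢⱼ = dⱼμᵢⱼ`, `d_{j+1} = dⱼB_j`, everything integral) [Cohen1993].
-/

noncomputable section

namespace Literature.Algebra.EuclideanLattices

open InnerProductSpace Finset GPVSampler
open scoped RealInnerProductSpace

namespace Babai

/-! ### The recursion on abstract integer data -/

/-- **Back-substitution on integer Gram–Schmidt data.** Data for `n` basis rows: `lamB i j = Λⱼ(bᵢ)`,
`lamW j = Λⱼ(w)` (the target row), `d j = d_{j+1}`. Last coefficient `z = roundDiv (Λ_{n-1}(w)) d_n`;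
recurse on the prefix levels with the target row `Λⱼ(w) - z Λⱼ(b_{n-1})`. [cite: Babai1986, §3; Cohen1993, Algorithm 2.6.7] -/
def intBackSub : (n : ℕ) → (Fin n → Fin n → ℤ) → (Fin n → ℤ) → (Fin n → ℤ) → (Fin n → ℤ)
  | 0, _, _, _ => fun i => i.elim0
  | n + 1, lamB, lamW, d =>
      let z : ℤ := roundDiv (lamW (Fin.last n)) (d (Fin.last n))
      Fin.snoc
        (intBackSub n (fun i j => lamB (Fin.castSucc i) (Fin.castSucc j))
          (fun j => lamW (Fin.castSucc j) - z * lamB (Fin.last n) (Fin.castSucc j))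
          (fun j => d (Fin.castSucc j)))
        z

/-- Unfolding of one step. [folklore] -/
theorem intBackSub_succ (n : ℕ) (lamB : Fin (n + 1) → Fin (n + 1) → ℤ) (lamW d : Fin (n + 1) → ℤ) :
    intBackSub (n + 1) lamB lamW d =
      Fin.snoc
        (intBackSub n (fun i j => lamB (Fin.castSucc i) (Fin.castSucc j))
          (fun j => lamW (Fin.castSucc j) -
            roundDiv (lamW (Fin.last n)) (d (Fin.last n)) * lamB (Fin.last n) (Fin.castSucc j))
          (fun j => d (Fin.castSucc j)))
        (roundDiv (lamW (Fin.last n)) (d (Fin.last n))) := rfl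

/-! ### It is Babai's algorithm, for any positive scalings -/

variable {V : Type*} [NormedAddCommGroup V] [InnerProductSpace ℝ V]

/-- **Back-substitution on scaled Gram–Schmidt data is Babai's nearest-plane algorithm.** If every
Gram–Schmidt vector of `f` is nonzero and the integer data are `lamB i j = Kⱼ⟪fᵢ, b̃ⱼ⟫`, `lamW j = Kⱼ⟪c, b̃ⱼ⟫`,
`d j = Kⱼ‖b̃ⱼ‖²` for positive reals `Kⱼ`, then `intBackSub n lamB lamW d = nearestPlane n f c`.
[cite: Babai1986, §3] -/
theorem intBackSub_eq_nearestPlane : ∀ (n : ℕ) (f : Fin n → V) (_ : ∀ j, gramSchmidt ℝ f j ≠ 0) (c : V)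
    (K : Fin n → ℝ) (_ : ∀ j, 0 < K j) (lamB : Fin n → Fin n → ℤ) (lamW d : Fin n → ℤ)
    (_ : ∀ i j, (lamB i j : ℝ) = K j * ⟪f i, gramSchmidt ℝ f j⟫)
    (_ : ∀ j, (lamW j : ℝ) = K j * ⟪c, gramSchmidt ℝ f j⟫)
    (_ : ∀ j, (d j : ℝ) = K j * ‖gramSchmidt ℝ f j‖ ^ 2),
    intBackSub n lamB lamW d = nearestPlane n f c
  | 0, _, _, _, _, _, _, _, _, _, _, _ => funext fun i => i.elim0
  | n + 1, f, hf, c, K, hK, lamB, lamW, d, hB, hW, hd => by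
      set z : ℤ := roundDiv (lamW (Fin.last n)) (d (Fin.last n)) with hz
      have hgs : 0 < ‖gramSchmidt ℝ f (Fin.last n)‖ ^ 2 := pow_pos (norm_pos_iff.2 (hf _)) 2
      have hdpos' : (0 : ℝ) < d (Fin.last n) := by rw [hd]; exact mul_pos (hK _) hgs
      have hdpos : 0 < d (Fin.last n) := by exact_mod_cast hdpos'
      -- the last coefficient is `round (lastCenter f c)`
      have hround : z = round (lastCenter f c) := by
        rw [hz, roundDiv_eq_round _ hdpos, hW, hd, lastCenter]
        congr 1
        have hK0 : K (Fin.last n) ≠ 0 := (hK _).ne'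
        field_simp
      -- the prefix family: same Gram–Schmidt vectors
      have hprefix : ∀ j : Fin n, gramSchmidt ℝ (f ∘ Fin.castSucc) j = gramSchmidt ℝ f (Fin.castSucc j) :=
        fun j => Literature.Analysis.InnerProduct.gramSchmidt_comp_castSucc ℝ f j
      have hf' : ∀ j : Fin n, gramSchmidt ℝ (f ∘ Fin.castSucc) j ≠ 0 := fun j => by rw [hprefix]; exact hf _
      -- the recursive call sees the data of `(f ∘ castSucc, c - z f_last)` with the scalings `K ∘ castSucc`
      have hrec := intBackSub_eq_nearestPlane n (f ∘ Fin.castSucc) hf' (c - (z : ℝ) • f (Fin.last n))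
        (K ∘ Fin.castSucc) (fun j => hK _)
        (fun i j => lamB (Fin.castSucc i) (Fin.castSucc j))
        (fun j => lamW (Fin.castSucc j) - z * lamB (Fin.last n) (Fin.castSucc j))
        (fun j => d (Fin.castSucc j))
        (fun i j => by simp only [Function.comp_apply, hprefix]; exact hB _ _)
        (fun j => by
          simp only [Function.comp_apply, hprefix]
          push_cast
          rw [hW, hB, inner_sub_smul_gramSchmidt]
          ring)
        (fun j => by simp only [Function.comp_apply, hprefix]; exact hd _)
      rw [intBackSub_succ, ← hz, hrec, nearestPlane_succ, ← hround]

/-! ### With Cohen's data of the extended family -/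

variable {m : ℕ}

/-- The entries of Cohen's table of the extended family at level `j < n`, cast to `ℝ`: for every row `i`
(a basis row or the target row), `u_j(i, j) = dⱼ ⟪rowᵢ, b̃ⱼ⟫` with `dⱼ`, `b̃ⱼ` those of the basis rows.
[cite: Cohen1993, Algorithm 2.6.7] -/
theorem uRec_snoc_level_cast {n : ℕ} (b : Fin n → (Fin m → ℤ)) (w : Fin m → ℤ)
    (hli : LinearIndependent ℝ (rowsR b)) (i : Fin (n + 1)) (j : Fin n) :
    (uRec (Fin.snoc b w : Fin (n + 1) → (Fin m → ℤ)) j i (Fin.castSucc j) : ℝ) =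
      gramDet (rowsR b) j (le_of_lt j.isLt) *
        ⟪rowsR (Fin.snoc b w : Fin (n + 1) → (Fin m → ℤ)) i, gramSchmidt ℝ (rowsR b) j⟫ := by
  have h1 := uRec_snoc_cast_eq_gsU b w hli j (le_of_lt j.isLt) i (Fin.castSucc j)
  have h2 := gsU_self_right (rowsR (Fin.snoc b w : Fin (n + 1) → (Fin m → ℤ))) i (Fin.castSucc j)
  simp only [Fin.val_castSucc] at h2
  have h3 : gramDet (rowsR (Fin.snoc b w : Fin (n + 1) → (Fin m → ℤ))) ((Fin.castSucc j : Fin (n + 1)) : ℕ)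
      (le_of_lt (Fin.castSucc j).isLt) = gramDet (rowsR b) j (le_of_lt j.isLt) :=
    gramDet_rowsR_snoc b w j (le_of_lt j.isLt)
  rw [h1, h2, gsNum, h3, gramSchmidt_rowsR_snoc_castSucc]

/-- The `d`'s of the extended family up to level `n` are those of the basis rows, cast to `ℝ`:
`dRec (b, w) (j+1) = d_{j+1} = dⱼ ‖b̃ⱼ‖²` (`j < n`). [cite: Cohen1993, Algorithm 2.6.7] -/
theorem dRec_snoc_succ_cast {n : ℕ} (b : Fin n → (Fin m → ℤ)) (w : Fin m → ℤ)
    (hli : LinearIndependent ℝ (rowsR b)) (j : Fin n) :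
    (dRec (Fin.snoc b w : Fin (n + 1) → (Fin m → ℤ)) (j + 1) : ℝ) =
      gramDet (rowsR b) j (le_of_lt j.isLt) * ‖gramSchmidt ℝ (rowsR b) j‖ ^ 2 := by
  have hj : (j : ℕ) < n + 1 := by omega
  simp only [dRec, dif_pos hj]
  have h1 := uRec_snoc_cast_eq_gsU b w hli j (le_of_lt j.isLt) ⟨j, hj⟩ ⟨j, hj⟩
  have h2 := gsU_self (rowsR (Fin.snoc b w : Fin (n + 1) → (Fin m → ℤ))) ⟨j, hj⟩
  have h3 : gramDet (rowsR (Fin.snoc b w : Fin (n + 1) → (Fin m → ℤ))) ((⟨j, hj⟩ : Fin (n + 1)) + 1)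
      (⟨j, hj⟩ : Fin (n + 1)).isLt = gramDet (rowsR b) (j + 1) j.isLt :=
    gramDet_rowsR_snoc b w (j + 1) j.isLt
  rw [h1, h2, h3, gramDet_succ]

/-- **Back-substitution on Cohen's table of the extended family is the integer nearest-plane algorithm**
(linearly independent integer rows): with `lamB i j = uRec (b, w) j i j`, `lamW j = uRec (b, w) j n j`,
`d j = dRec (b, w) (j + 1)`, `intBackSub n lamB lamW d = intNearestPlane n b w`.
[cite: Babai1986, §3; Cohen1993, Algorithm 2.6.7] -/
theorem intBackSub_uRec_eq_intNearestPlane {n : ℕ} (b : Fin n → (Fin m → ℤ)) (w : Fin m → ℤ)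
    (hli : LinearIndependent ℝ (rowsR b)) :
    intBackSub n
        (fun i j => uRec (Fin.snoc b w : Fin (n + 1) → (Fin m → ℤ)) j (Fin.castSucc i) (Fin.castSucc j))
        (fun j => uRec (Fin.snoc b w : Fin (n + 1) → (Fin m → ℤ)) j (Fin.last n) (Fin.castSucc j))
        (fun j => dRec (Fin.snoc b w : Fin (n + 1) → (Fin m → ℤ)) (j + 1)) =
      intNearestPlane n b w := by
  rw [intNearestPlane_eq n b hli w]
  have hgs : ∀ j, gramSchmidt ℝ (rowsR b) j ≠ 0 := fun j => gramSchmidt_ne_zero j hli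
  refine intBackSub_eq_nearestPlane n (rowsR b) hgs (intVecToEuclidean m w)
    (fun j => gramDet (rowsR b) j (le_of_lt j.isLt))
    (fun j => lt_of_lt_of_le one_pos (one_le_gramDet b hli j (le_of_lt j.isLt))) _ _ _
    (fun i j => ?_) (fun j => ?_) (fun j => dRec_snoc_succ_cast b w hli j)
  · rw [uRec_snoc_level_cast b w hli]
    congr 1
    exact congrArg (fun v => ⟪v, gramSchmidt ℝ (rowsR b) j⟫) (congrFun (rowsR_snoc_comp_castSucc b w) i)
  · rw [uRec_snoc_level_cast b w hli, rowsR_snoc_last]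

/-- **Consequently the residual of the back-substitution is Babai's residual**:
`w - ∑ zᵢ bᵢ = intResidual b w` for the coefficients `z` of `intBackSub` on Cohen's data. [cite: Babai1986, §3] -/
theorem sub_sum_intBackSub_smul_eq_intResidual {n : ℕ} (b : Fin n → (Fin m → ℤ)) (w : Fin m → ℤ)
    (hli : LinearIndependent ℝ (rowsR b)) :
    w - ∑ i, intBackSub n
        (fun i j => uRec (Fin.snoc b w : Fin (n + 1) → (Fin m → ℤ)) j (Fin.castSucc i) (Fin.castSucc j))
        (fun j => uRec (Fin.snoc b w : Fin (n + 1) → (Fin m → ℤ)) j (Fin.last n) (Fin.castSucc j))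
        (fun j => dRec (Fin.snoc b w : Fin (n + 1) → (Fin m → ℤ)) (j + 1)) i • b i =
      intResidual b w := by
  rw [intBackSub_uRec_eq_intNearestPlane b w hli, intResidual]

end Babai

end Literature.Algebra.EuclideanLattices

end
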